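import Summits.QuantumAdvantage.AdviceFreeQNC0.WalkTubeRank
import Summits.QuantumAdvantage.AdviceFreeQNC0.AffBells22WalkHardAllSubcube
import Summits.QuantumAdvantage.AdviceFreeQNC0.OddPrimeTransport
import Summits.QuantumAdvantage.AdviceFreeQNC0.RingHardOdd
import HarnessLib

/-!
# Sketch23 §1–§2 (planner qn-p1 g23, ROUND-22 §1; ask P-23c): the GENERALISED-BELL walk game — `walkHardGen`

Verbatim copy of `HOME/qa-qnc0-p1/exp23/Sketch23.lean` §1 and §2 (authored by the planner seat qn-p1 g23, landed by qn-prover-3 g12;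
only this header and one docstring are new).  A walk strategy with ARBITRARY per-bell path-pattern index `pat b` and ARBITRARY per-bell
phase `κ b` still has `[WIN] = tr f` with `f = Σ_b ι(y_b)·ω^{κ b}·χ_{a^{(pat b)}} ∈ fullSpan n D` (`iotaF_ringWinGen`, `stratFunGen_mem_fullSpan`),
so the tube-rank chain (`FullSpanFailMass`, = the tree's `failSet_ge_of_mem_fullSpan`) gives **`walkHardGenSqrt`** (free-bit degree `√n`) and
**`walkHardGen`** (generalised bells, polylog degree), and `walkHardF_two_of_gen` recovers `WalkHardF 2`.  §2 types the subcube split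
(`wtPrefixOn`, `freeBefore`, statement `WalkExpSplit`).  Separation NOT moved.
-/

noncomputable section

open Classical

namespace Summit.QuantumAdvantage.AdviceFreeQNC0

open Finset
open Literature.Computability.QuantumComplexity Literature.Computability.QuantumComplexity.RingHLF
open Literature.Computability.MetaComplexity Literature.Computability.MetaComplexity.Smolensky
open F4 TubePlanProof AffBells22

namespace AffBells23

/-! ## §1 The GENERALISED-BELL walk game: arbitrary path pattern and phase per bell -/

variable {n m : ℕ}

/-- WIN of the generalised walk game: bells `b : Fin m`, bell `b` sits at path pattern `a^{(pat b)}` with phase `κ b`; the number of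
`1`-outputs at bells with `κ b + walkExp u (pat b) ≢ 0 (mod 3)` is odd.  `ringWinU c y` is the case `m = n+1`, `pat g = g`, `κ g = c + g`. -/
def ringWinGen (pat κ : Fin m → ℕ) (y : Fin m → (Fin n → Bool) → Bool) (u : Fin n → Bool) : Bool :=
  decide ((univ.filter fun b : Fin m => y b u = true ∧ (κ b + walkExp u (pat b)) % 3 ≠ 0).card % 2 = 1)

/-- The original walk game is the generalised game with `pat = id`, `κ g = c + g` (definitional). -/
theorem ringWinU_eq_ringWinGen (c : ℕ) (y : Fin (n + 1) → (Fin n → Bool) → Bool) (u : Fin n → Bool) :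
    ringWinU c y u = ringWinGen (fun g : Fin (n + 1) => g.val) (fun g => c + g.val) y u := rfl

/-- The generalised strategy function `f(u) = Σ_b [y_b(u)]·ω^{κ b + walkExp u (pat b)}`. -/
def stratFunGen (pat κ : Fin m → ℕ) (y : Fin m → (Fin n → Bool) → Bool) (u : Fin n → Bool) : F4 :=
  ∑ b : Fin m, ιF (y b u) * ω ^ (κ b + walkExp u (pat b))

/-- `tr (ι(b)·x) = ι(b)·tr x`. -/
private theorem tr_iotaF_mul' (b : Bool) (x : F4) : tr (ιF b * x) = ιF b * tr x := by
  unfold ιF; cases b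
  · simp [tr_zero]
  · simp

/-- **The generalised game is a trace** (copy of `WalkFailFloor.iotaF_ringWinU`; additivity of `tr` and `tr ω^s = [3 ∤ s]` do not care
about patterns or phases). -/
theorem iotaF_ringWinGen (pat κ : Fin m → ℕ) (y : Fin m → (Fin n → Bool) → Bool) (u : Fin n → Bool) :
    ιF (ringWinGen pat κ y u) = tr (stratFunGen pat κ y u) := by
  classical
  unfold stratFunGen
  rw [tr_sum]
  have e : ∀ b : Fin m, tr (ιF (y b u) * ω ^ (κ b + walkExp u (pat b))) =
      if (y b u = true ∧ (κ b + walkExp u (pat b)) % 3 ≠ 0) then 1 else 0 := by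
    intro b
    rw [tr_iotaF_mul', tr_omega_pow]
    unfold ιF
    by_cases h1 : y b u = true <;> by_cases h2 : (κ b + walkExp u (pat b)) % 3 = 0 <;> simp [h1, h2]
  rw [Finset.sum_congr rfl fun b _ => e b, ← Finset.natCast_card_filter, natCast_eq]
  unfold ringWinGen ιF
  by_cases h : (univ.filter fun b : Fin m => y b u = true ∧ (κ b + walkExp u (pat b)) % 3 ≠ 0).card % 2 = 1
  · rw [if_pos h, decide_eq_true h, if_pos rfl]
  · rw [if_neg h]
    have hd : decide ((univ.filter fun b : Fin m =>
        y b u = true ∧ (κ b + walkExp u (pat b)) % 3 ≠ 0).card % 2 = 1) = false := decide_eq_false h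
    rw [hd]
    simp

/-- `f = Σ_b ω^{κ b} · ([y_b] χ_{a^{(pat b)}})`. -/
theorem stratFunGen_eq (pat κ : Fin m → ℕ) (y : Fin m → (Fin n → Bool) → Bool) :
    stratFunGen pat κ y = fun u => ∑ b : Fin m, ω ^ (κ b) * (ιF (y b u) * chi (aPat (pat b)) u) := by
  funext u
  unfold stratFunGen
  refine Finset.sum_congr rfl fun b _ => ?_
  rw [pow_add, omega_pow_walkExp]
  ring

/-- **The generalised strategy function of a degree-`D` strategy lies in the full module `M_D(P)`** (copy of
`stratFun_mem_fullSpan`: `fullSpan` is an `𝔽₄`-span over ALL path patterns, so per-bell phases and repeated patterns are free). -/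
theorem stratFunGen_mem_fullSpan {D : ℕ} (pat κ : Fin m → ℕ) (y : Fin m → (Fin n → Bool) → Bool)
    (hy : ∀ b, HasDeg (y b) D) : stratFunGen pat κ y ∈ fullSpan n D := by
  rw [stratFunGen_eq]
  have e : (fun u => ∑ b : Fin m, ω ^ (κ b) * (ιF (y b u) * chi (aPat (pat b)) u)) =
      ∑ b : Fin m, (ω ^ (κ b) • fun u => ιF (y b u) * chi (aPat (pat b)) u) := by
    funext u
    simp only [Finset.sum_apply, Pi.smul_apply, smul_eq_mul]
  rw [e]
  exact Submodule.sum_mem _ fun b _ =>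
    Submodule.smul_mem _ _ (polySpan_mul_chi_mem (iotaF_mem_polySpan (hy b)) (pat b))

/-- Win set and fail set of the generalised strategy function are complementary (copy of `card_win_add_card_failSetOf`). -/
theorem card_winGen_add_card_failSetOf (pat κ : Fin m → ℕ) (y : Fin m → (Fin n → Bool) → Bool) :
    (univ.filter fun u : Fin n → Bool => ringWinGen pat κ y u = true).card +
      (failSetOf (stratFunGen pat κ y)).card = 2 ^ n := by
  haveI := F4.nontrivial
  have e : failSetOf (stratFunGen pat κ y) = univ.filter fun u : Fin n → Bool => ¬ ringWinGen pat κ y u = true := by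
    unfold failSetOf
    refine filter_congr fun u _ => ?_
    rw [← iotaF_ringWinGen]
    unfold ιF
    cases ringWinGen pat κ y u <;> simp
  rw [e, card_filter_add_card_filter_not, card_univ, Fintype.card_fun, Fintype.card_bool, Fintype.card_fin]

/-- **`FullSpanFailMass`** — the tube chain in its natural generality: every `f ∈ M_D(P)` on `m ≥ m₀` bits with `D ≤ √m` has
`tr f ≠ 1` on at least `c·2^m` inputs.  (= the middle of `WalkTubeRank.tubePlan`, which fixes `D = (log₂ m)^C` only to get `D ≤ √m`.) -/
def FullSpanFailMass : Prop :=
  ∃ c : ℝ, 0 < c ∧ ∃ m₀ : ℕ, ∀ m ≥ m₀, ∀ D : ℕ, D ≤ Nat.sqrt m → ∀ f : (Fin m → Bool) → F4, f ∈ fullSpan m D →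
    c * (2 : ℝ) ^ m ≤ ((failSetOf f).card : ℝ)

/-- `FullSpanFailMass` is the TREE theorem `failSet_ge_of_mem_fullSpan` (AffBells22SubcubeWalk.lean, p614393, landed 2026-08-28 while this
sketch was being written; body identical). -/
theorem fullSpanFailMass : FullSpanFailMass := failSet_ge_of_mem_fullSpan

/-- **`WalkHardGenSqrt`** — generalised-bell walk hardness for `𝔽₂`-degree `≤ √n`: ONE `θ < 1`, any number of bells, any patterns, any phases. -/
def WalkHardGenSqrt : Prop :=
  ∃ θ : ℝ, θ < 1 ∧ ∃ n₀ : ℕ, ∀ n ≥ n₀, ∀ (m : ℕ) (pat κ : Fin m → ℕ) (y : Fin m → (Fin n → Bool) → Bool),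
    (∀ b, HasDeg (y b) (Nat.sqrt n)) →
      ((univ.filter fun u : Fin n → Bool => ringWinGen pat κ y u = true).card : ℝ) ≤ θ * (2 : ℝ) ^ n

/-- **`WalkHardGen`** — the same at every polylog degree (the shape of `WalkHardF 2` / `WalkHardAll`, generalised bells). -/
def WalkHardGen : Prop :=
  ∃ θ : ℝ, θ < 1 ∧ ∀ C : ℕ, ∃ n₀ : ℕ, ∀ n ≥ n₀, ∀ (m : ℕ) (pat κ : Fin m → ℕ) (y : Fin m → (Fin n → Bool) → Bool),
    (∀ b, HasDeg (y b) ((Nat.log 2 n) ^ C)) →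
      ((univ.filter fun u : Fin n → Bool => ringWinGen pat κ y u = true).card : ℝ) ≤ θ * (2 : ℝ) ^ n

/-- `FullSpanFailMass → WalkHardGenSqrt` (PROVED: `f = stratFunGen ∈ M_{√n}(P)`, `#WIN + #FAIL = 2ⁿ`, `θ = 1 − c`). -/
theorem walkHardGenSqrt_of_failMass (h : FullSpanFailMass) : WalkHardGenSqrt := by
  obtain ⟨c, hc, m₀, hm⟩ := h
  refine ⟨1 - c, by linarith, m₀, fun n hn m pat κ y hy => ?_⟩
  have hf : stratFunGen pat κ y ∈ fullSpan n (Nat.sqrt n) := stratFunGen_mem_fullSpan pat κ y hy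
  have h1 := hm n hn (Nat.sqrt n) le_rfl (stratFunGen pat κ y) hf
  have h2 := card_winGen_add_card_failSetOf pat κ y
  have h2R : ((univ.filter fun u : Fin n → Bool => ringWinGen pat κ y u = true).card : ℝ) +
      ((failSetOf (stratFunGen pat κ y)).card : ℝ) = (2 : ℝ) ^ n := by exact_mod_cast h2
  linarith

/-- `WalkHardGenSqrt → WalkHardGen` (PROVED: `(log₂ n)^C ≤ √n` eventually, `TubePlanProof.logPow_le_natSqrt`). -/
theorem walkHardGen_of_sqrt (h : WalkHardGenSqrt) : WalkHardGen := by
  obtain ⟨θ, hθ, n₀, hn₀⟩ := h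
  refine ⟨θ, hθ, fun C => ?_⟩
  obtain ⟨n₁, hn₁⟩ := logPow_le_natSqrt C
  refine ⟨max n₀ n₁, fun n hn m pat κ y hy => ?_⟩
  have h0 : n₀ ≤ n := le_trans (le_max_left _ _) hn
  have h1 : n₁ ≤ n := le_trans (le_max_right _ _) hn
  exact hn₀ n h0 m pat κ y fun b => lowDeg_mono (hn₁ n h1) (hy b)

/-- In particular the generalised game contains the original one: `WalkHardGen → WalkHardF 2` (PROVED, definitional instance). -/
theorem walkHardF_two_of_gen (h : WalkHardGen) : WalkHardF 2 := by
  obtain ⟨θ, hθ, hC⟩ := h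
  refine ⟨θ, hθ, fun C => ?_⟩
  obtain ⟨n₀, hn₀⟩ := hC C
  refine ⟨n₀, fun n hn c y hy => ?_⟩
  have := hn₀ n hn (n + 1) (fun g => g.val) (fun g => c + g.val) y hy
  simpa [ringWinU_eq_ringWinGen] using this

/-- **`WalkHardGenSqrt` — PROVED, unconditional.** -/
theorem walkHardGenSqrt : WalkHardGenSqrt := walkHardGenSqrt_of_failMass fullSpanFailMass

/-- **`WalkHardGen` — PROVED, unconditional** (generalised bells, every polylog degree; contains `walkHardF_two`). -/
theorem walkHardGen : WalkHardGen := walkHardGen_of_sqrt walkHardGenSqrt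

/-! ## §2 CONDITIONING ON A COORDINATE SUBCUBE is a generalised-bell game on the free bits -/

/-! `AffBells22.subcubeMerge`, `AffBells22.WalkHardAllSubcube δ₀` and the theorem `walkHardAllSubcube : δ₀ < 1 → WalkHardAllSubcube δ₀`
are TREE declarations since 2026-08-28T08:03Z (AffBells22SubcubeWalk.lean p614393 + AffBells22WalkHardAllSubcube.lean p614955, qn-lit g24 /
qn-prover-3 g12).  The identity below records WHY conditioning is a generalised-bell game (not needed by the tree proof, which re-indexes directly). -/

/-- prefix weight of the FIXED bits: `#{i ∈ S : i < g, b_i = 1}`. -/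
def wtPrefixOn (S : Finset (Fin n)) (b : Fin n → Bool) (g : ℕ) : ℕ :=
  (S.filter fun i => i.val < g ∧ b i = true).card

/-- number of free coordinates before cut `g`: the path-pattern index of cut `g` in the free game. -/
def freeBefore (S : Finset (Fin n)) (g : ℕ) : ℕ := ((univ \ S).filter fun i : Fin n => i.val < g).card

/-- **(L1) walk-exponent splitting** (prover target, S: `Finset.orderEmbOfFin` bookkeeping): with `e : Fin m' ↪o Fin n` the increasing
enumeration of `univ \ S` (`m' = n − |S|`) and `u' = u ∘ e` the free bits,
`walkExp (subcubeMerge S b u) g = (wt_S b + wtPrefixOn S b g) + walkExp u' (freeBefore S g)`.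
Stated with the free part pulled back along an arbitrary strictly monotone enumeration `e` of the complement. -/
def WalkExpSplit : Prop :=
  ∀ (n m' : ℕ) (S : Finset (Fin n)) (e : Fin m' → Fin n), StrictMono e → (∀ i, e i ∉ S) → (∀ j, j ∉ S → ∃ i, e i = j) →
    ∀ (b u : Fin n → Bool) (g : ℕ),
      walkExp (subcubeMerge S b u) g =
        ((S.filter fun i => b i = true).card + wtPrefixOn S b g) + walkExp (fun i : Fin m' => u (e i)) (freeBefore S g)

end AffBells23

end Summit.QuantumAdvantage.AdviceFreeQNC0
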